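import Literature.Topology.NoetherianSpaces.NoetherianConnectedComponent
import HarnessLib

/-!
# In a Noetherian topological space an arbitrary intersection of open-and-closed subsets is open-and-closed

Topic `Literature/Topology/NoetherianSpaces`; namespace `Literature.Topology.NoetherianSpaces` (sequel of ★ `NoetherianConnectedComponent`:
connected components of a Noetherian space are clopen — `isClopen_connectedComponent_of_noetherianSpace`, reused, not restated).  THEOREMS ONLY (no definition, no named fact, no instance, no notation,
no `sorry`).  Cell `hodgecm-mathlib` (D-0151), P6 «MOD programme» (crux hLiu418 = stmt-HodgeConjecture-24832), line-candidate
`F0_P6a_IsomSchemeFiniteType`, sub-organ **(Ia)** of `stub_ICON` (A-p14 (g34) census `CENSUS-ICON-IsomConditionsLocus.v1` §2): the `Isom`-conditions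
«`ι₁(a) ≫ U = U ≫ ι₂(a)` for EVERY `a ∈ 𝒪`» are an arbitrary family of OPEN-AND-CLOSED equality loci of homomorphisms of abelian schemes
([MumfordFogartyKirwan1994] Ch. 6 §1 Cor. 6.2; ★ `AbelianSchemes/HomEqualityLocusClosed`) on a Noetherian base, and this file says their
intersection is still open-and-closed (hence an open subscheme, quasi-compact).  HC_CM is proved only modulo the 2 remaining named inputs
(hLiu418, h413) until rung 0 closes; this file is generic and changes no count.

## The mathematics

A Noetherian topological space has finitely many irreducible components (Mathlib `NoetherianSpace.finite_irreducibleComponents`); every point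
lies in one of them and an irreducible set is connected, so the map «irreducible component ↦ its connected component» is onto and there are
finitely many CONNECTED COMPONENTS ([StacksProject] Tag 0052 with Tag 04MF; [GortzWedhorn2020] §(3.11)).  An open-and-closed subset is a union of
connected components (Mathlib `IsClopen.biUnion_connectedComponent_eq`), so it is determined by its image in the (finite) set of connected
components: there are finitely many open-and-closed subsets, and any intersection of them is a finite intersection, hence open-and-closed.

* `finite_connectedComponents_of_noetherianSpace` — `Finite (ConnectedComponents X)`.
* `finite_setOf_isClopen_of_noetherianSpace` — `{s | IsClopen s}` is finite.
* **`isClopen_iInter_of_noetherianSpace`**, `isClopen_sInter_of_noetherianSpace` — arbitrary intersections of clopens are clopen;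
  `isOpen_iInter_of_isClopen_of_noetherianSpace` (the open half, the form the equality-loci consumer reads).

## References
* [StacksProject] The Stacks Project, Tag 0052 (Noetherian spaces: finitely many irreducible components), Tag 04MF (connected components).
* [GortzWedhorn2020] U. Görtz, T. Wedhorn, *Algebraic Geometry I*, 2nd ed. (2020), §(3.11) and Exercise 3.16.
* [MumfordFogartyKirwan1994] D. Mumford, J. Fogarty, F. Kirwan, *Geometric Invariant Theory*, 3rd ed. (1994), Ch. 6 §1 Corollary 6.2 (p. 116).
-/

set_option autoImplicit false

open Set TopologicalSpace

universe u

namespace Literature.Topology.NoetherianSpaces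

variable {X : Type u} [TopologicalSpace X]

/-- **A Noetherian topological space has finitely many connected components**: every point lies in an irreducible component (Mathlib
`irreducibleComponent_mem_irreducibleComponents`), which is connected, so «irreducible component ↦ connected component of any of its points» is a
surjection from the finite set of irreducible components (Mathlib `NoetherianSpace.finite_irreducibleComponents`).
[cite: StacksProject, Tag 0052 and Tag 04MF] [cite: GortzWedhorn2020, Section (3.11)] -/
theorem finite_connectedComponents_of_noetherianSpace [NoetherianSpace X] : Finite (ConnectedComponents X) := by
  haveI : Finite (irreducibleComponents X) := NoetherianSpace.finite_irreducibleComponents.to_subtype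
  -- every irreducible component is non-empty: choose a point
  have hne : ∀ Z : irreducibleComponents X, (Z : Set X).Nonempty := fun Z => Z.2.1.nonempty
  choose pt hpt using hne
  refine Finite.of_surjective (fun Z : irreducibleComponents X => (pt Z : ConnectedComponents X)) fun c => ?_
  induction c using ConnectedComponents.surjective_coe.forall.2 with
  | _ x =>
    let Z : irreducibleComponents X := ⟨irreducibleComponent x, irreducibleComponent_mem_irreducibleComponents x⟩
    refine ⟨Z, ?_⟩
    -- the chosen point of `irreducibleComponent x` lies in the connected component of `x`
    have hz : pt Z ∈ irreducibleComponent x := hpt Z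
    rw [ConnectedComponents.coe_eq_coe']
    exact isIrreducible_irreducibleComponent.isConnected.isPreconnected.subset_connectedComponent
      mem_irreducibleComponent hz

/-- **A Noetherian topological space has finitely many open-and-closed subsets**: a clopen set is the union of the connected components of its
points (Mathlib `IsClopen.biUnion_connectedComponent_eq`), i.e. the preimage of its image in the finite set `ConnectedComponents X`
(Mathlib `connectedComponents_preimage_image`). [cite: StacksProject, Tag 04MF] [cite: GortzWedhorn2020, Section (3.11)] -/
theorem finite_setOf_isClopen_of_noetherianSpace [NoetherianSpace X] : {s : Set X | IsClopen s}.Finite := by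
  haveI := finite_connectedComponents_of_noetherianSpace (X := X)
  -- `s ↦ image of s in the connected components` is injective on clopen sets
  have hinj : Set.InjOn (fun s : Set X => ((↑) '' s : Set (ConnectedComponents X))) {s | IsClopen s} := by
    intro s hs t ht hst
    have hs' : ((↑) : X → ConnectedComponents X) ⁻¹' ((↑) '' s) = s := by
      rw [connectedComponents_preimage_image, IsClopen.biUnion_connectedComponent_eq hs]
    have ht' : ((↑) : X → ConnectedComponents X) ⁻¹' ((↑) '' t) = t := by
      rw [connectedComponents_preimage_image, IsClopen.biUnion_connectedComponent_eq ht]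
    rw [← hs', ← ht']
    exact congrArg _ hst
  exact Set.Finite.of_finite_image (Set.toFinite _) hinj

/-- **Arbitrary intersections of open-and-closed subsets of a Noetherian space are open-and-closed** (the family has finite range).
[cite: StacksProject, Tag 0052 and Tag 04MF] [cite: MumfordFogartyKirwan1994, Ch. 6 §1 Corollary 6.2 (p. 116)] -/
theorem isClopen_sInter_of_noetherianSpace [NoetherianSpace X] (S : Set (Set X)) (hS : ∀ s ∈ S, IsClopen s) : IsClopen (⋂₀ S) := by
  have hfin : S.Finite := (finite_setOf_isClopen_of_noetherianSpace (X := X)).subset fun s hs => hS s hs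
  exact ⟨isClosed_sInter fun s hs => (hS s hs).isClosed, hfin.isOpen_sInter fun s hs => (hS s hs).isOpen⟩

/-- **Arbitrary indexed intersections of open-and-closed subsets of a Noetherian space are open-and-closed.**
[cite: StacksProject, Tag 0052 and Tag 04MF] [cite: MumfordFogartyKirwan1994, Ch. 6 §1 Corollary 6.2 (p. 116)] -/
theorem isClopen_iInter_of_noetherianSpace [NoetherianSpace X] {ι : Sort*} (U : ι → Set X) (hU : ∀ i, IsClopen (U i)) :
    IsClopen (⋂ i, U i) := by
  rw [← sInter_range]
  exact isClopen_sInter_of_noetherianSpace _ (by rintro _ ⟨i, rfl⟩; exact hU i)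

/-- The open half: **an arbitrary intersection of open-and-closed subsets of a Noetherian space is OPEN** (so, on a Noetherian scheme, it
is an open subscheme — quasi-compact — representing the conjunction of the conditions the clopens represent).
[cite: StacksProject, Tag 0052 and Tag 04MF] [cite: MumfordFogartyKirwan1994, Ch. 6 §1 Corollary 6.2 (p. 116)] -/
theorem isOpen_iInter_of_isClopen_of_noetherianSpace [NoetherianSpace X] {ι : Sort*} (U : ι → Set X) (hU : ∀ i, IsClopen (U i)) :
    IsOpen (⋂ i, U i) :=
  (isClopen_iInter_of_noetherianSpace U hU).isOpen

end Literature.Topology.NoetherianSpaces
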